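import Literature.Barriers.QuantumAdvantage.UncorrectedNoiseMachineCoef
import Literature.Computability.Complexity.StackBricksStrings
import HarnessLib

/-!
# The noisy-IQP simulating machine, V: the coefficient table and the sequential sampler

Support file for the discharge of `bremnerMontanaroShepherd2017_thm4`
(`Literature/Barriers/QuantumAdvantage/UncorrectedNoise.lean`): Bremner–Montanaro–Shepherd 2017,
§3.1 (store the `n^{O(ℓ)}` damped coefficients) and §3.2 (sample bit by bit from the marginals,
the truncated procedure `Alg`), in the `FP`-brick algebra, with exact values:

* the item cell `itemFn ℓ P C R2` of a counter (`itemFn_apply`: `encList [⟨tupleCode l, dpEnc (coefInt …)⟩]`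
  for canonical digit tuples, `ε` otherwise), the clocked table loop `tableFn` over
  `c < (N+1)^ℓ` (`binPowFn`, `cntFn`), the cell bound `cellK` that unclips it and
  **`tableFn_cellK_apply`** (`= encList (tableList …)`);
* signed-integer size bounds `length_zaddF_le_add`, `length_znegF_le`;
* the scaled prefix sums as a fold over the table: `contrFn`/`sumFn`, `sumFn_table`
  (`= dpEnc (Σ_{canonical c} contrVal …)`), `tVal`;
* one sampling step: fields, `tFn`, the coin block `uFn` (`blockVal r m k`), `2^m`, the
  comparison `cmpFn`, the decided bit `bitFn_apply = [decBit m T0 T1 u]`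
  (`decBit`: `1` if `T0 < 0`, `0` if `T1 < 0`, else `[2^m T0 ≤ u (T0+T1)]`), `opSampFn`;
* the sampling loop `sampLoopFn` and **`sampLoopFn_apply`**: its value is the recursion
  `sampleRun ℓ P C R2 x gates r m N`.

## References

* [BremnerMontanaroShepherd2017] M. J. Bremner, A. Montanaro, D. J. Shepherd, *Achieving quantum
  supremacy with sparse and noisy commuting quantum computations*, Quantum 1 (2017) 8, §3.1–3.2.
* S. Arora, B. Barak, *Computational Complexity: A Modern Approach*, CUP 2009, §1.3.
-/

namespace Literature.Barriers.QuantumAdvantage.NoisyIQPMachine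

open _root_.Computability Literature.Computability.Complexity Literature.Computability.Complexity.Brick
  Literature.Computability.Complexity.Plumb Literature.Computability.Cryptography

variable {N : ℕ}

/-! ### The item cell of a counter and the coefficient table

Context: `ctxQ = ⟨x, ⟨1^N, G⟩⟩`; piece argument `⟨ctxQ, 1^c⟩`. -/

section Table

variable (ℓ P : ℕ) (C : ℕ → ℕ) (R2 : ℕ)

/-- The tuple of the counter: `digitsFn ℓ ⟨1^{N+1}, 1^c⟩`. [folklore] -/
noncomputable def iTupleFn : List Bool → List Bool :=
  digitsFn ℓ ∘ fanoutFn (List.cons true ∘ nthF 1 ∘ fstF) sndF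

/-- `iTupleFn ∈ FP`. [folklore] -/
theorem iTupleFn_mem_FP : iTupleFn ℓ ∈ FP :=
  comp_mem_FP (digitsFn_mem_FP ℓ) (fanoutFn_mem_FP (comp_mem_FP (cons_mem_FP true) (comp_mem_FP (nthF_mem_FP 1) fstF_mem_FP))
    sndF_mem_FP)

/-- The context `⟨x, ⟨1^N, G⟩⟩`. [folklore] -/
def ctxQ (x : List Bool) (N : ℕ) (G : List Bool) : List Bool := boolPair x (boolPair (ones N) G)

/-- Value of `iTupleFn`. [folklore] -/
theorem iTupleFn_apply (x : List Bool) (G : List Bool) (c : ℕ) :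
    iTupleFn ℓ (boolPair (ctxQ x N G) (ones c)) = tupleCode (baseDigits (N + 1) ℓ c) := by
  simp only [iTupleFn, ctxQ, Function.comp_apply, fanoutFn_apply, fstF_boolPair, sndF_boolPair, nthF]
  rw [show true :: ones N = ones (N + 1) by simp [ones, List.replicate_succ], digitsFn_apply]

/-- **The item cell**: `encList [⟨T, Q⟩]` if the counter's tuple `T` is canonical, else `ε`.
[cite: BremnerMontanaroShepherd2017, §3.1 (the stored coefficients)] -/
noncomputable def itemFn : List Bool → List Bool :=
  iteFn (canonFn ∘ fanoutFn (nthF 1 ∘ fstF) (iTupleFn ℓ))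
    (fanoutFn (fanoutFn (iTupleFn ℓ) (qFn ℓ P C R2 ∘ fanoutFn fstF (iTupleFn ℓ))) (fun _ => []))
    (fun _ => [])

/-- `itemFn ∈ FP`. [folklore] -/
theorem itemFn_mem_FP : itemFn ℓ P C R2 ∈ FP :=
  iteFn_mem_FP (comp_mem_FP canonFn_mem_FP (fanoutFn_mem_FP (comp_mem_FP (nthF_mem_FP 1) fstF_mem_FP) (iTupleFn_mem_FP ℓ)))
    (fanoutFn_mem_FP (fanoutFn_mem_FP (iTupleFn_mem_FP ℓ) (comp_mem_FP (qFn_mem_FP ℓ P C R2)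
      (fanoutFn_mem_FP fstF_mem_FP (iTupleFn_mem_FP ℓ)))) (const_mem_FP _)) (const_mem_FP _)

/-- The mathematical item of a counter: `⟨tupleCode l, dpEnc (coefInt …)⟩`. [folklore] -/
def itemCode (x : List Bool) (L : List (QGate iqpDiag N)) (c : ℕ) : List Bool :=
  boolPair (tupleCode (baseDigits (N + 1) ℓ c))
    (dpEnc (coefInt P C R2 L (zOfInput N x) (tupleShift N (baseDigits (N + 1) ℓ c))))

/-- **Value of the item cell.** [folklore] -/
theorem itemFn_apply (x : List Bool) (hx : x.length ≤ N) (L : List (QGate iqpDiag N)) (c : ℕ) :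
    itemFn ℓ P C R2 (boolPair (ctxQ x N (encList (L.map QGate.encode))) (ones c)) =
      if IsCanon N (baseDigits (N + 1) ℓ c) then boolPair (itemCode ℓ P C R2 x L c) [] else [] := by
  have hT := iTupleFn_apply (N := N) ℓ x (encList (L.map QGate.encode)) c
  have hruler : nthF 1 (ctxQ x N (encList (L.map QGate.encode))) = ones N := by simp [ctxQ, nthF]
  unfold itemFn
  rw [iteFn_apply (b := decide (IsCanon N (baseDigits (N + 1) ℓ c))) (by
    rw [Function.comp_apply, fanoutFn_apply, Function.comp_apply, fstF_boolPair, hruler, hT]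
    exact canonFn_apply N _)]
  by_cases h : IsCanon N (baseDigits (N + 1) ℓ c)
  · rw [if_pos (decide_eq_true h), if_pos h, fanoutFn_apply, fanoutFn_apply, hT, Function.comp_apply,
      fanoutFn_apply, fstF_boolPair, hT, itemCode]
    rw [show boolPair (ctxQ x N (encList (L.map QGate.encode))) (tupleCode (baseDigits (N + 1) ℓ c)) =
      qArg x N (encList (L.map QGate.encode)) (tupleCode (baseDigits (N + 1) ℓ c)) from rfl,
      qFn_apply ℓ P C R2 h (fun q hq => le_of_mem_baseDigits_succ hq) (length_baseDigits _ _ _).le hx]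
  · rw [if_neg (fun h' => h (of_decide_eq_true h')), if_neg h]

end Table

end Literature.Barriers.QuantumAdvantage.NoisyIQPMachine

namespace Literature.Barriers.QuantumAdvantage.NoisyIQPMachine

open _root_.Computability Literature.Computability.Complexity Literature.Computability.Complexity.Brick
  Literature.Computability.Complexity.Plumb Literature.Computability.Cryptography

variable {N : ℕ}

/-! ### The coefficient table: one clocked loop over the counters `c < (N+1)^ℓ` -/

section TableLoop

variable (ℓ P : ℕ) (C : ℕ → ℕ) (R2 : ℕ)

/-- `binPowFn k u = bin (⟦u⟧^k)`. [folklore] -/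
noncomputable def binPowFn : ℕ → List Bool → List Bool
  | 0 => fun _ => encodeNat 1
  | k + 1 => prodFn ∘ fanoutFn id (binPowFn k)

/-- `binPowFn k ∈ FP`. [folklore] -/
theorem binPowFn_mem_FP : ∀ k : ℕ, binPowFn k ∈ FP
  | 0 => const_mem_FP _
  | k + 1 => comp_mem_FP prodFn_mem_FP (fanoutFn_mem_FP OracleCompose.id_mem_FP (binPowFn_mem_FP k))

/-- Value of `binPowFn`. [folklore] -/
theorem binPowFn_apply : ∀ (k : ℕ) (u : List Bool), binPowFn k u = encodeNat (bitsToNat u ^ k)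
  | 0, u => by simp [binPowFn]
  | k + 1, u => by
    rw [binPowFn, Function.comp_apply, fanoutFn_apply, prodFn_boolPair, id, binPowFn_apply k u, bitsToNat_encodeNat,
      pow_succ, mul_comm]

/-- The number of counters `bin ((N+1)^ℓ)`, from the context `⟨x, ⟨1^N, G⟩⟩`. [folklore] -/
noncomputable def cntFn : List Bool → List Bool := binPowFn ℓ ∘ lenBinF ∘ List.cons true ∘ nthF 1

/-- `cntFn ∈ FP`. [folklore] -/
theorem cntFn_mem_FP : cntFn ℓ ∈ FP :=
  comp_mem_FP (binPowFn_mem_FP ℓ) (comp_mem_FP lenBinF_mem_FP (comp_mem_FP (cons_mem_FP true) (nthF_mem_FP 1)))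

/-- Value of `cntFn`. [folklore] -/
theorem cntFn_apply (x : List Bool) (G : List Bool) : cntFn ℓ (ctxQ x N G) = encodeNat ((N + 1) ^ ℓ) := by
  simp only [cntFn, ctxQ, Function.comp_apply, nthF, fstF_boolPair, sndF_boolPair, lenBinF_apply, List.length_cons,
    List.length_replicate, binPowFn_apply, bitsToNat_encodeNat]

/-- The start record of the table loop `⟨ctxQ, ⟨cnt, ⟨1^0, ε⟩⟩⟩`. [folklore] -/
noncomputable def tableInitFn : List Bool → List Bool := fanoutFn id (fanoutFn (cntFn ℓ) (fun _ => boolPair [] []))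

/-- `tableInitFn ∈ FP`. [folklore] -/
theorem tableInitFn_mem_FP : tableInitFn ℓ ∈ FP :=
  fanoutFn_mem_FP OracleCompose.id_mem_FP (fanoutFn_mem_FP (cntFn_mem_FP ℓ) (const_mem_FP _))

/-- **The coefficient table**: the concatenation of the item cells over all counters (the item
function clipped at `K`, `foldLoop` of `FoldBricks.lean`). [cite: BremnerMontanaroShepherd2017, §3.1 ("approximating and storing enough Fourier coefficients … in time n^{O(ℓ)}")] -/
noncomputable def tableFn (K : ℕ) : List Bool → List Bool :=
  sndPow 2 ∘ foldLoop appF (clipF K (itemFn ℓ P C R2)) ((Polynomial.X + 1) ^ ℓ) ∘ tableInitFn ℓ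

/-- **`tableFn ∈ FP`.** [cite: AroraBarak2009, §1.3 (polynomially bounded loops)] -/
theorem tableFn_mem_FP (K : ℕ) : tableFn ℓ P C R2 K ∈ FP :=
  comp_mem_FP (sndPow_mem_FP 2) (comp_mem_FP (foldLoop_clipF_mem_FP K appF_mem_FP length_appF_le (itemFn_mem_FP ℓ P C R2) _)
    (tableInitFn_mem_FP ℓ))

/-- The mathematical table: the item codes of the canonical counters, in counter order. [folklore] -/
def tableList (x : List Bool) (L : List (QGate iqpDiag N)) : List (List Bool) :=
  ((List.range ((N + 1) ^ ℓ)).filter fun c => decide (IsCanon N (baseDigits (N + 1) ℓ c))).map (itemCode ℓ P C R2 x L)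

/-- Appending one cell to a coded list. [folklore] -/
theorem encList_append_singleton (l : List (List Bool)) (a : List Bool) : encList (l ++ [a]) = encList l ++ boolPair a [] := by
  rw [Com.encList_eq_flatMap, Com.encList_eq_flatMap, List.flatMap_append]
  simp [boolPair]

/-- Concatenating the cells gives the coded table. [folklore] -/
theorem ccat_cells (canon : ℕ → Prop) [DecidablePred canon] (item : ℕ → List Bool) : ∀ k : ℕ,
    ccat (fun j => if canon j then boolPair (item j) [] else []) k =
      encList (((List.range k).filter fun c => decide (canon c)).map item)
  | 0 => by simp
  | k + 1 => by
    rw [ccat_succ, ccat_cells canon item k, List.range_succ, List.filter_append, List.map_append]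
    by_cases h : canon k
    · rw [if_pos h, List.filter_singleton, decide_eq_true h]; simp [encList_append_singleton]
    · rw [if_neg h, List.filter_singleton, decide_eq_false h]; simp

/-- **Value of the table** (given the cell bound that unclips the loop). [folklore] -/
theorem tableFn_apply (K : ℕ) (x : List Bool) (hx : x.length ≤ N) (L : List (QGate iqpDiag N))
    (hK : ∀ c, c < (N + 1) ^ ℓ → (itemFn ℓ P C R2 (boolPair (ctxQ x N (encList (L.map QGate.encode))) (ones c))).length ≤
      K * ((ctxQ x N (encList (L.map QGate.encode))).length + 1)) :
    tableFn ℓ P C R2 K (ctxQ x N (encList (L.map QGate.encode))) = encList (tableList ℓ P C R2 x L) := by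
  have hinit : tableInitFn ℓ (ctxQ x N (encList (L.map QGate.encode))) =
      boolPair (ctxQ x N (encList (L.map QGate.encode))) (boolPair (encodeNat ((N + 1) ^ ℓ)) (boolPair (ones 0) [])) := by
    rw [tableInitFn, fanoutFn_apply, fanoutFn_apply, cntFn_apply]; rfl
  have hrounds : (N + 1) ^ ℓ ≤ ((Polynomial.X + 1) ^ ℓ : Polynomial ℕ).eval (ctxQ x N (encList (L.map QGate.encode))).length := by
    rw [Polynomial.eval_pow, Polynomial.eval_add, Polynomial.eval_X, Polynomial.eval_one]
    exact Nat.pow_le_pow_left (by simp [ctxQ]; omega) ℓ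
  rw [tableFn, Function.comp_apply, Function.comp_apply, hinit, foldLoop_apply _ _ hrounds 0 _]
  simp only [sndPow, Function.comp_apply, sndF_boolPair]
  rw [foldAcc_clipF (fun j _ hj => hK j (by omega)), foldAcc_appF, List.nil_append, tableList]
  rw [← ccat_cells (fun c => IsCanon N (baseDigits (N + 1) ℓ c)) (itemCode ℓ P C R2 x L)]
  refine ccat_congr fun j _ => ?_
  rw [zero_add, itemFn_apply ℓ P C R2 x hx L j]

/-! ### The size of a cell -/

/-- A bound on the bit-length of the constants: `max_j |bin C_j| + max (|bin 2^P|, |bin R2|)`.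
[folklore] -/
def constBits : ℕ := (Finset.range (ℓ + 1)).sup (fun j => (encodeNat (C j)).length) + max (P + 1) (encodeNat R2).length

/-- A tuple code of `ℓ` entries `≤ N` has length `≤ ℓ (2N + 2)`. [folklore] -/
theorem length_tupleCode_le (l : List ℕ) (hle : ∀ q ∈ l, q ≤ N) : (tupleCode l).length ≤ l.length * (2 * N + 2) := by
  rw [tupleCode, length_encList, List.map_map]
  induction l with
  | nil => simp
  | cons p l ih =>
    rw [List.map_cons, List.sum_cons, List.length_cons, Nat.succ_mul]
    have hp := hle p (by simp)
    have := ih (fun q hq => hle q (by simp [hq]))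
    simp only [Function.comp_apply, List.length_replicate] at this ⊢
    nlinarith

/-- `a ≤ 2` for every nonzero wire code. [folklore] -/
theorem wireCode_snd_le {si : Bool} {t d e a : ℕ} (h : wireCode si t d = some (e, a)) : a ≤ 2 := by
  unfold wireCode at h
  split_ifs at h <;> cases h <;> omega

/-- `Σa ≤ 2N`. [folklore] -/
theorem totA_le (L : List (QGate iqpDiag N)) (s : QReg N) : totA L s ≤ 2 * N := by
  unfold totA
  calc ∑ i : Fin N, ((wireCodeAt L s i).getD (0, 0)).2 ≤ ∑ _i : Fin N, 2 := Finset.sum_le_sum fun i _ => by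
          cases h : wireCodeAt L s i with
          | none => simp
          | some v => obtain ⟨e, a⟩ := v; simpa using wireCode_snd_le h
    _ = 2 * N := by simp [mul_comm]

/-- The bit-length of a stored coefficient. [folklore] -/
theorem length_dpEnc_coefInt_le (L : List (QGate iqpDiag N)) (z s : QReg N) (hcard : (supp s).card ≤ ℓ) :
    (dpEnc (coefInt P C R2 L z s)).length ≤ 2 * (constBits ℓ P C R2 + N + 1) + 2 := by
  unfold coefInt
  by_cases hz : anyZero L s
  · rw [if_pos hz]
    simp [dpEnc, boolPair, show encodeNat 0 = [] from rfl]
  rw [if_neg hz]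
  set m : ℕ := C (supp s).card * 2 ^ (totA L s / 2) * (if totA L s % 2 = 0 then 2 ^ P else R2) with hm
  have hbits : (encodeNat m).length ≤ constBits ℓ P C R2 + N + 1 := by
    have h1 : (encodeNat (C (supp s).card)).length ≤ (Finset.range (ℓ + 1)).sup (fun j => (encodeNat (C j)).length) :=
      Finset.le_sup (f := fun j => (encodeNat (C j)).length) (Finset.mem_range.2 (Nat.lt_succ_of_le hcard))
    have h2 : (encodeNat (2 ^ (totA L s / 2))).length ≤ N + 1 := by
      rw [TM2Pass.length_encodeNat_eq_size, Nat.size_pow]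
      have := totA_le L s; omega
    have h3 : (encodeNat (if totA L s % 2 = 0 then 2 ^ P else R2)).length ≤ max (P + 1) (encodeNat R2).length := by
      split_ifs
      · rw [TM2Pass.length_encodeNat_eq_size, Nat.size_pow]; exact le_max_left _ _
      · exact le_max_right _ _
    have h12 := Literature.Computability.Complexity.length_encodeNat_mul_le (C (supp s).card) (2 ^ (totA L s / 2))
    have h123 := Literature.Computability.Complexity.length_encodeNat_mul_le (C (supp s).card * 2 ^ (totA L s / 2))
      (if totA L s % 2 = 0 then 2 ^ P else R2)
    rw [hm]
    unfold constBits
    omega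
  have hsign : coefSign L z s = 1 ∨ coefSign L z s = -1 := by
    have h := coefSign_sq L z s
    have h' : ((coefSign L z s : ℝ) - 1) * ((coefSign L z s : ℝ) + 1) = 0 := by nlinarith
    rcases mul_eq_zero.1 h' with h1 | h1
    · left; exact_mod_cast (sub_eq_zero.1 h1)
    · right; exact_mod_cast (eq_neg_of_add_eq_zero_left h1)
  rcases hsign with h1 | h1
  · rw [h1, one_mul, dpEnc_natCast', length_boolPair, List.length_nil]; omega
  · rw [h1, neg_one_mul, dpEnc_neg_natCast', length_boolPair, List.length_nil]; omega

/-- **The cell bound**: `K = 8ℓ + 4·constBits + 14` unclips the table loop. [folklore] -/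
def cellK : ℕ := 8 * ℓ + 4 * constBits ℓ P C R2 + 14

/-- Every cell is short relative to the context. [folklore] -/
theorem length_itemFn_le (x : List Bool) (hx : x.length ≤ N) (L : List (QGate iqpDiag N)) (c : ℕ) :
    (itemFn ℓ P C R2 (boolPair (ctxQ x N (encList (L.map QGate.encode))) (ones c))).length ≤
      cellK ℓ P C R2 * ((ctxQ x N (encList (L.map QGate.encode))).length + 1) := by
  rw [itemFn_apply ℓ P C R2 x hx L c]
  split_ifs with hcanon
  · have hle : ∀ q ∈ baseDigits (N + 1) ℓ c, q ≤ N := fun q hq => le_of_mem_baseDigits_succ hq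
    have hT := length_tupleCode_le (baseDigits (N + 1) ℓ c) hle
    rw [length_baseDigits] at hT
    have hcard : (supp (tupleShift N (baseDigits (N + 1) ℓ c))).card ≤ ℓ := by
      rw [supp_tupleShift, card_tupleSet hcanon hle]
      exact (List.length_filter_le _ _).trans (length_baseDigits _ _ _).le
    have hQ := length_dpEnc_coefInt_le ℓ P C R2 L (zOfInput N x) (tupleShift N (baseDigits (N + 1) ℓ c)) hcard
    have hctx : 2 * N + 4 ≤ (ctxQ x N (encList (L.map QGate.encode))).length := by simp [ctxQ]; omega
    rw [length_boolPair, List.length_nil, itemCode, length_boolPair]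
    unfold cellK
    nlinarith
  · exact Nat.zero_le _

/-- **Value of the table** with the canonical cell bound. [folklore] -/
theorem tableFn_cellK_apply (x : List Bool) (hx : x.length ≤ N) (L : List (QGate iqpDiag N)) :
    tableFn ℓ P C R2 (cellK ℓ P C R2) (ctxQ x N (encList (L.map QGate.encode))) = encList (tableList ℓ P C R2 x L) :=
  tableFn_apply ℓ P C R2 _ x hx L (fun c _ => length_itemFn_le ℓ P C R2 x hx L c)

end TableLoop

end Literature.Barriers.QuantumAdvantage.NoisyIQPMachine

namespace Literature.Barriers.QuantumAdvantage.NoisyIQPMachine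

open _root_.Computability Literature.Computability.Complexity Literature.Computability.Complexity.Brick
  Literature.Computability.Complexity.Plumb Literature.Computability.Cryptography

variable {N : ℕ}

/-! ### Signed-integer bricks: size bounds -/

/-- The size of a pair code: `|dpEnc v| ≤ 2|bin v⁺| + |bin v⁻| + 2`. [folklore] -/
theorem length_dpEnc (v : ℤ) : (dpEnc v).length = 2 * (encodeNat v.toNat).length + 2 + (encodeNat (-v).toNat).length := by
  rw [dpEnc, length_boolPair]

/-- **Addition is size-additive**: `|zaddF ⟨a, b⟩| ≤ |a| + |b| + 4`. [folklore] -/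
theorem length_zaddF_le_add (a b : List Bool) : (zaddF (boolPair a b)).length ≤ a.length + b.length + 4 := by
  rw [zaddF_boolPair, length_dpEnc]
  have ha := length_fstF_sndF_le a
  have hb := length_fstF_sndF_le b
  unfold ival
  rcases le_or_gt 0 ((bitsToNat (fstF a) : ℤ) - bitsToNat (sndF a) + ((bitsToNat (fstF b) : ℤ) - bitsToNat (sndF b))) with h | h
  · have hneg : (-((bitsToNat (fstF a) : ℤ) - bitsToNat (sndF a) + ((bitsToNat (fstF b) : ℤ) - bitsToNat (sndF b)))).toNat = 0 :=
      Int.toNat_of_nonpos (by linarith)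
    rw [hneg, show encodeNat 0 = [] from rfl, List.length_nil, add_zero]
    have hle : ((bitsToNat (fstF a) : ℤ) - bitsToNat (sndF a) + ((bitsToNat (fstF b) : ℤ) - bitsToNat (sndF b))).toNat ≤
        bitsToNat (fstF a) + bitsToNat (fstF b) := by
      rw [Int.toNat_le]; push_cast; linarith [Int.natCast_nonneg (bitsToNat (sndF a)), Int.natCast_nonneg (bitsToNat (sndF b))]
    have h1 := length_encodeNat_mono hle
    have h2 := Brick.length_encodeNat_add_le (fstF a) (fstF b)
    omega
  · have hpos : (((bitsToNat (fstF a) : ℤ) - bitsToNat (sndF a) + ((bitsToNat (fstF b) : ℤ) - bitsToNat (sndF b)))).toNat = 0 :=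
      Int.toNat_of_nonpos h.le
    rw [hpos, show encodeNat 0 = [] from rfl, List.length_nil, mul_zero, zero_add]
    have hle : (-((bitsToNat (fstF a) : ℤ) - bitsToNat (sndF a) + ((bitsToNat (fstF b) : ℤ) - bitsToNat (sndF b)))).toNat ≤
        bitsToNat (sndF a) + bitsToNat (sndF b) := by
      rw [Int.toNat_le]; push_cast; linarith [Int.natCast_nonneg (bitsToNat (fstF a)), Int.natCast_nonneg (bitsToNat (fstF b))]
    have h1 := length_encodeNat_mono hle
    have h2 := Brick.length_encodeNat_add_le (sndF a) (sndF b)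
    omega

/-- **Negation at most doubles**: `|znegF w| ≤ 2|w| + 2`. [folklore] -/
theorem length_znegF_le (w : List Bool) : (znegF w).length ≤ 2 * w.length + 2 := by
  rw [znegF_eq, length_dpEnc, neg_neg]
  have hw := length_fstF_sndF_le w
  unfold ival
  rcases le_or_gt 0 ((bitsToNat (fstF w) : ℤ) - bitsToNat (sndF w)) with h | h
  · rw [Int.toNat_of_nonpos (by linarith), show encodeNat 0 = [] from rfl, List.length_nil, mul_zero, zero_add]
    have hle : (((bitsToNat (fstF w) : ℤ) - bitsToNat (sndF w))).toNat ≤ bitsToNat (fstF w) := by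
      rw [Int.toNat_le]; linarith [Int.natCast_nonneg (bitsToNat (sndF w))]
    have h1 := (length_encodeNat_mono hle).trans (length_encodeNat_bitsToNat_le _)
    omega
  · rw [Int.toNat_of_nonpos h.le, show encodeNat 0 = [] from rfl, List.length_nil, add_zero]
    have hle : (-((bitsToNat (fstF w) : ℤ) - bitsToNat (sndF w))).toNat ≤ bitsToNat (sndF w) := by
      rw [Int.toNat_le]; linarith [Int.natCast_nonneg (bitsToNat (fstF w))]
    have h1 := (length_encodeNat_mono hle).trans (length_encodeNat_bitsToNat_le _)
    omega

/-! ### The scaled prefix sums `T_{y'}` (a fold over the table)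

Fold context `prm = ⟨y', ⟨1^{K}, 1^N⟩⟩` (`y'` the prefix extended by the trial bit, `K = |y'|`),
items `⟨T, Q⟩`. -/

/-- The contribution of an item: `0` if `S ⊄ [K]`, else `±Q` by the parity of `#{j : y'[p_j] = 1}`. [folklore] -/
noncomputable def contrFn : List Bool → List Bool :=
  iteFn (belowOrBlankFn ∘ fanoutFn (sndF ∘ fstF ∘ fstF) (fstF ∘ fstF ∘ sndF))
    (iteFn (notFn (isNilFn ∘ modKFn 2 ∘ markedCountFn ∘ fanoutFn (fstF ∘ fstF ∘ fstF) (fstF ∘ fstF ∘ sndF)))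
      (znegF ∘ sndF ∘ fstF ∘ sndF) (sndF ∘ fstF ∘ sndF))
    (fun _ => dpEnc 0)

/-- `contrFn ∈ FP`. [folklore] -/
theorem contrFn_mem_FP : contrFn ∈ FP :=
  iteFn_mem_FP (comp_mem_FP belowOrBlankFn_mem_FP (fanoutFn_mem_FP (comp_mem_FP sndF_mem_FP (comp_mem_FP fstF_mem_FP fstF_mem_FP))
    (comp_mem_FP fstF_mem_FP (comp_mem_FP fstF_mem_FP sndF_mem_FP))))
    (iteFn_mem_FP (notFn_mem_FP (comp_mem_FP isNilFn_mem_FP (comp_mem_FP (modKFn_mem_FP 2) (comp_mem_FP markedCountFn_mem_FP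
      (fanoutFn_mem_FP (comp_mem_FP fstF_mem_FP (comp_mem_FP fstF_mem_FP fstF_mem_FP))
        (comp_mem_FP fstF_mem_FP (comp_mem_FP fstF_mem_FP sndF_mem_FP)))))))
      (comp_mem_FP znegF_mem_FP (comp_mem_FP sndF_mem_FP (comp_mem_FP fstF_mem_FP sndF_mem_FP)))
      (comp_mem_FP sndF_mem_FP (comp_mem_FP fstF_mem_FP sndF_mem_FP))) (const_mem_FP _)

/-- `contrFn` is short: `≤ 2|item| + 2`. [folklore] -/
theorem length_contrFn_le (v : List Bool) : (contrFn v).length ≤ 2 * (fstF (sndF v)).length + 2 := by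
  unfold contrFn
  rw [iteFn_of_oneBit (oneBit_belowOrBlankFn.comp _)]
  split_ifs
  · rw [iteFn_of_oneBit (oneBit_notFn (oneBit_isNilFn.comp _))]
    have h := length_fstF_sndF_le (fstF (sndF v))
    split_ifs
    · exact (length_znegF_le _).trans (by simp only [Function.comp_apply]; omega)
    · simp only [Function.comp_apply]; omega
  · simp [dpEnc, boolPair, show encodeNat 0 = [] from rfl]

/-- The fold step `acc := acc + contribution`. [folklore] -/
noncomputable def sumStep : List Bool → List Bool := zaddF ∘ fanoutFn (sndF ∘ sndF) contrFn

/-- `sumStep ∈ FP`. [folklore] -/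
theorem sumStep_mem_FP : sumStep ∈ FP :=
  comp_mem_FP zaddF_mem_FP (fanoutFn_mem_FP (comp_mem_FP sndF_mem_FP sndF_mem_FP) contrFn_mem_FP)

/-- Growth of `sumStep`. [folklore] -/
theorem foldGrowth_sumStep : FoldGrowth 6 sumStep := fun v => by
  unfold sumStep
  rw [Function.comp_apply, fanoutFn_apply]
  have h1 := length_zaddF_le_add (sndF (sndF v)) (contrFn v)
  have h2 := length_contrFn_le v
  simp only [Function.comp_apply] at h1 ⊢
  nlinarith

/-- **The scaled prefix sum** `sumFn ⟨⟨y', ⟨1^K, 1^N⟩⟩, table⟩`. [cite: BremnerMontanaroShepherd2017, §3.1 (the sums S_y)] -/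
noncomputable def sumFn : List Bool → List Bool := foldFn sumStep (fun _ => dpEnc 0)

/-- `sumFn ∈ FP`. [cite: AroraBarak2009, §1.3] -/
theorem sumFn_mem_FP : sumFn ∈ FP := foldFn_mem_FP sumStep_mem_FP (const_mem_FP _) foldGrowth_sumStep

/-- The mathematical contribution of the counter `c` to `T_{y'}` at range `K`. [folklore] -/
def contrVal (ℓ P : ℕ) (C : ℕ → ℕ) (R2 : ℕ) (x : List Bool) (L : List (QGate iqpDiag N)) (K : ℕ) (y' : List Bool) (c : ℕ) : ℤ :=
  if ∀ p ∈ baseDigits (N + 1) ℓ c, p < K ∨ p = N then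
    (if (baseDigits (N + 1) ℓ c).countP (fun p => y'.getD p false = true) % 2 = 0 then 1 else -1) *
      coefInt P C R2 L (zOfInput N x) (tupleShift N (baseDigits (N + 1) ℓ c))
  else 0

/-- Value of `contrFn` on an item code. [folklore] -/
theorem contrFn_itemCode (ℓ P : ℕ) (C : ℕ → ℕ) (R2 : ℕ) (x : List Bool) (L : List (QGate iqpDiag N)) (K : ℕ)
    (y' table acc : List Bool) (c : ℕ) :
    contrFn (boolPair (boolPair (boolPair y' (boolPair (ones K) (ones N))) table) (boolPair (itemCode ℓ P C R2 x L c) acc)) =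
      dpEnc (contrVal ℓ P C R2 x L K y' c) := by
  set l := baseDigits (N + 1) ℓ c
  unfold contrFn contrVal
  rw [iteFn_apply (b := decide (∀ p ∈ l, p < K ∨ p = N)) (by
    simp only [Function.comp_apply, fanoutFn_apply, fstF_boolPair, sndF_boolPair, itemCode]
    exact belowOrBlankFn_apply K N l)]
  by_cases hr : ∀ p ∈ l, p < K ∨ p = N
  · rw [if_pos (decide_eq_true hr), if_pos hr]
    rw [iteFn_apply (b := !decide (l.countP (fun p => y'.getD p false = true) % 2 = 0)) (by
      rw [notFn_apply]
      simp only [Function.comp_apply, fanoutFn_apply, fstF_boolPair, sndF_boolPair, itemCode]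
      rw [markedCountFn_apply, modKFn_apply, List.length_replicate, isNilFn_ones])]
    by_cases hp : l.countP (fun p => y'.getD p false = true) % 2 = 0
    · rw [decide_eq_true hp, if_pos hp, one_mul]
      simp [itemCode]
    · rw [decide_eq_false hp, if_neg hp, neg_one_mul]
      simp [itemCode, znegF_eq]
  · rw [if_neg (fun h => hr (of_decide_eq_true h)), if_neg hr]

/-- The fold over item codes as an integer sum. [folklore] -/
theorem foldl_sumStep (ℓ P : ℕ) (C : ℕ → ℕ) (R2 : ℕ) (x : List Bool) (L : List (QGate iqpDiag N)) (K : ℕ)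
    (y' table : List Bool) : ∀ (cs : List ℕ) (v : ℤ),
    (cs.map (itemCode ℓ P C R2 x L)).foldl
        (fun acc a => sumStep (boolPair (boolPair (boolPair y' (boolPair (ones K) (ones N))) table) (boolPair a acc))) (dpEnc v) =
      dpEnc (v + (cs.map (contrVal ℓ P C R2 x L K y')).sum)
  | [], v => by simp
  | c :: cs, v => by
    rw [List.map_cons, List.foldl_cons, List.map_cons, List.sum_cons]
    have hstep : sumStep (boolPair (boolPair (boolPair y' (boolPair (ones K) (ones N))) table)
        (boolPair (itemCode ℓ P C R2 x L c) (dpEnc v))) = dpEnc (v + contrVal ℓ P C R2 x L K y' c) := by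
      rw [sumStep, Function.comp_apply, fanoutFn_apply, zaddF_boolPair, contrFn_itemCode]
      simp
    rw [hstep, foldl_sumStep ℓ P C R2 x L K y' table cs, add_assoc]

/-- **Value of `sumFn` on the table**: the integer `T_{y'}^{(K)} = Σ_{canonical c} contrVal`. [folklore] -/
theorem sumFn_table (ℓ P : ℕ) (C : ℕ → ℕ) (R2 : ℕ) (x : List Bool) (L : List (QGate iqpDiag N)) (K : ℕ) (y' : List Bool) :
    sumFn (boolPair (boolPair y' (boolPair (ones K) (ones N))) (encList (tableList ℓ P C R2 x L))) =
      dpEnc ((((List.range ((N + 1) ^ ℓ)).filter fun c => decide (IsCanon N (baseDigits (N + 1) ℓ c))).map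
        (contrVal ℓ P C R2 x L K y')).sum) := by
  rw [sumFn, foldFn_boolPair, decNil_encList, tableList]
  have := foldl_sumStep ℓ P C R2 x L K y' (encList (tableList ℓ P C R2 x L))
    ((List.range ((N + 1) ^ ℓ)).filter fun c => decide (IsCanon N (baseDigits (N + 1) ℓ c))) 0
  rw [zero_add] at this
  rw [← this]
  rfl

/-! ### One sampling step

Argument of the step: `v = ⟨y, ⟨xs, 1^k⟩⟩` with `xs = ⟨r, ⟨1^N, ⟨1^m, table⟩⟩⟩`. -/

/-- Field `y`. [folklore] -/
def syOf : List Bool → List Bool := fstF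
/-- Field `xs`. [folklore] -/
def sxsOf : List Bool → List Bool := fstF ∘ sndF
/-- Field `1^k`. [folklore] -/
def skOf : List Bool → List Bool := sndF ∘ sndF
/-- Field `r`. [folklore] -/
def srOf : List Bool → List Bool := fstF ∘ sxsOf
/-- Field `1^N`. [folklore] -/
def sRulerOf : List Bool → List Bool := nthF 1 ∘ sxsOf
/-- Field `1^m`. [folklore] -/
def smOf : List Bool → List Bool := nthF 2 ∘ sxsOf
/-- Field `table`. [folklore] -/
def sTableOf : List Bool → List Bool := sndPow 2 ∘ sxsOf

/-- `syOf ∈ FP`. [folklore] -/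
theorem syOf_mem_FP : syOf ∈ FP := fstF_mem_FP
/-- `sxsOf ∈ FP`. [folklore] -/
theorem sxsOf_mem_FP : sxsOf ∈ FP := comp_mem_FP fstF_mem_FP sndF_mem_FP
/-- `skOf ∈ FP`. [folklore] -/
theorem skOf_mem_FP : skOf ∈ FP := comp_mem_FP sndF_mem_FP sndF_mem_FP
/-- `srOf ∈ FP`. [folklore] -/
theorem srOf_mem_FP : srOf ∈ FP := comp_mem_FP fstF_mem_FP sxsOf_mem_FP
/-- `sRulerOf ∈ FP`. [folklore] -/
theorem sRulerOf_mem_FP : sRulerOf ∈ FP := comp_mem_FP (nthF_mem_FP 1) sxsOf_mem_FP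
/-- `smOf ∈ FP`. [folklore] -/
theorem smOf_mem_FP : smOf ∈ FP := comp_mem_FP (nthF_mem_FP 2) sxsOf_mem_FP
/-- `sTableOf ∈ FP`. [folklore] -/
theorem sTableOf_mem_FP : sTableOf ∈ FP := comp_mem_FP (sndPow_mem_FP 2) sxsOf_mem_FP

/-- The data record of the sampling loop. [folklore] -/
def sxs (r : List Bool) (N m : ℕ) (table : List Bool) : List Bool := boolPair r (boolPair (ones N) (boolPair (ones m) table))

/-- The argument of one sampling step. [folklore] -/
def sArg (y r : List Bool) (N m : ℕ) (table : List Bool) (k : ℕ) : List Bool := boolPair y (boolPair (sxs r N m table) (ones k))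

section StepFields

variable (y r : List Bool) (N m : ℕ) (table : List Bool) (k : ℕ)

/-- Reading the fields of the step argument. [folklore] -/
theorem sFields : syOf (sArg y r N m table k) = y ∧ skOf (sArg y r N m table k) = ones k ∧ srOf (sArg y r N m table k) = r ∧
    sRulerOf (sArg y r N m table k) = ones N ∧ smOf (sArg y r N m table k) = ones m ∧ sTableOf (sArg y r N m table k) = table := by
  simp [syOf, skOf, srOf, sRulerOf, smOf, sTableOf, sxsOf, sArg, sxs, nthF, sndPow]

end StepFields

/-- The argument of `sumFn` for the trial bit `b`: `⟨⟨y ++ [b], ⟨1^{k+1}, 1^N⟩⟩, table⟩`. [folklore] -/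
noncomputable def sumArgFn (b : Bool) : List Bool → List Bool :=
  fanoutFn (fanoutFn (fun v => syOf v ++ [b]) (fanoutFn (List.cons true ∘ skOf) sRulerOf)) sTableOf

/-- `sumArgFn b ∈ FP`. [folklore] -/
theorem sumArgFn_mem_FP (b : Bool) : sumArgFn b ∈ FP :=
  fanoutFn_mem_FP (fanoutFn_mem_FP (append_mem_FP syOf_mem_FP (const_mem_FP _)) (fanoutFn_mem_FP
    (comp_mem_FP (cons_mem_FP true) skOf_mem_FP) sRulerOf_mem_FP)) sTableOf_mem_FP

/-- `T0`, `T1`: the scaled prefix sums of `y0`, `y1`. [folklore] -/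
noncomputable def tFn (b : Bool) : List Bool → List Bool := sumFn ∘ sumArgFn b

/-- `tFn b ∈ FP`. [folklore] -/
theorem tFn_mem_FP (b : Bool) : tFn b ∈ FP := comp_mem_FP sumFn_mem_FP (sumArgFn_mem_FP b)

/-- The coin block value `u = ⟦r[km, km+m)⟧` as a nonnegative pair code `⟨bin u, ε⟩`. [folklore] -/
noncomputable def uFn : List Bool → List Bool :=
  fanoutFn (lowBitsFn ∘ fanoutFn smOf (dropFn ∘ fanoutFn (HashBricks.umulFn ∘ fanoutFn skOf smOf) srOf)) (fun _ => [])

/-- `uFn ∈ FP`. [folklore] -/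
theorem uFn_mem_FP : uFn ∈ FP :=
  fanoutFn_mem_FP (comp_mem_FP lowBitsFn_mem_FP (fanoutFn_mem_FP smOf_mem_FP (comp_mem_FP dropFn_mem_FP
    (fanoutFn_mem_FP (comp_mem_FP HashBricks.umulFn_mem_FP (fanoutFn_mem_FP skOf_mem_FP smOf_mem_FP)) srOf_mem_FP)))) (const_mem_FP _)

/-- `2^m` as a pair code `⟨0^m 1, ε⟩`. [folklore] -/
noncomputable def twoPowMFn : List Bool → List Bool := fanoutFn (fun v => Kannan.zerosFn (smOf v) ++ [true]) (fun _ => [])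

/-- `twoPowMFn ∈ FP`. [folklore] -/
theorem twoPowMFn_mem_FP : twoPowMFn ∈ FP :=
  fanoutFn_mem_FP (append_mem_FP (comp_mem_FP Kannan.zerosFn_mem_FP smOf_mem_FP) (const_mem_FP _)) (const_mem_FP _)

/-- The comparison bit `[2^m T0 ≤ u (T0 + T1)]`. [cite: BremnerMontanaroShepherd2017, §3.2 (step 2(b): "with probability S_{y0}/S_y set y ← y0")] -/
noncomputable def cmpFn : List Bool → List Bool :=
  zleF ∘ fanoutFn (zmulF ∘ fanoutFn twoPowMFn (tFn false)) (zmulF ∘ fanoutFn uFn (zaddF ∘ fanoutFn (tFn false) (tFn true)))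

/-- `cmpFn ∈ FP`. [folklore] -/
theorem cmpFn_mem_FP : cmpFn ∈ FP :=
  comp_mem_FP zleF_mem_FP (fanoutFn_mem_FP (comp_mem_FP zmulF_mem_FP (fanoutFn_mem_FP twoPowMFn_mem_FP (tFn_mem_FP false)))
    (comp_mem_FP zmulF_mem_FP (fanoutFn_mem_FP uFn_mem_FP (comp_mem_FP zaddF_mem_FP (fanoutFn_mem_FP (tFn_mem_FP false) (tFn_mem_FP true))))))

/-- **The decided bit**: `1` if `T0 < 0`, else `0` if `T1 < 0`, else the comparison bit.
[cite: BremnerMontanaroShepherd2017, §3.2 (procedure, steps 2(a)–(b))] -/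
noncomputable def bitFn : List Bool → List Bool :=
  iteFn (iposFn ∘ zswapF ∘ tFn false) (fun _ => [true]) (iteFn (iposFn ∘ zswapF ∘ tFn true) (fun _ => [false]) cmpFn)

/-- `bitFn ∈ FP`. [folklore] -/
theorem bitFn_mem_FP : bitFn ∈ FP :=
  iteFn_mem_FP (comp_mem_FP iposFn_mem_FP (comp_mem_FP zswapF_mem_FP (tFn_mem_FP false))) (const_mem_FP _)
    (iteFn_mem_FP (comp_mem_FP iposFn_mem_FP (comp_mem_FP zswapF_mem_FP (tFn_mem_FP true))) (const_mem_FP _) cmpFn_mem_FP)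

/-- `bitFn` is one-bit. [folklore] -/
theorem oneBit_bitFn : OneBit bitFn :=
  (oneBit_iposFn.comp _).ite (oneBit_const true) ((oneBit_iposFn.comp _).ite (oneBit_const false) (oneBit_zleF.comp _))

/-- **The sampling step** `y := y ++ bit`. [cite: BremnerMontanaroShepherd2017, §3.2] -/
noncomputable def opSampFn : List Bool → List Bool := appF ∘ fanoutFn syOf bitFn

/-- `opSampFn ∈ FP`. [folklore] -/
theorem opSampFn_mem_FP : opSampFn ∈ FP := comp_mem_FP appF_mem_FP (fanoutFn_mem_FP syOf_mem_FP bitFn_mem_FP)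

/-- Growth of the sampling step: one symbol. [folklore] -/
theorem length_opSampFn_le (w : List Bool) : (opSampFn w).length ≤ (fstF w).length + (sndF w).length + 1 := by
  rw [opSampFn, Function.comp_apply, fanoutFn_apply, appF_boolPair, List.length_append, oneBit_bitFn.length_eq, syOf]
  omega

/-- The mathematical decision from the two scaled sums and the coin value. [cite: BremnerMontanaroShepherd2017, §3.2 (steps 2(a)–(b))] -/
def decBit (m : ℕ) (t0 t1 : ℤ) (u : ℕ) : Bool :=
  if t0 < 0 then true else if t1 < 0 then false else decide (2 ^ m * t0 ≤ u * (t0 + t1))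

/-- The scaled prefix sum `T^{(K)}_{y'}` read off the table (as a list sum over the canonical counters).
[folklore] -/
def tVal (ℓ P : ℕ) (C : ℕ → ℕ) (R2 : ℕ) (x : List Bool) (L : List (QGate iqpDiag N)) (K : ℕ) (y' : List Bool) : ℤ :=
  (((List.range ((N + 1) ^ ℓ)).filter fun c => decide (IsCanon N (baseDigits (N + 1) ℓ c))).map (contrVal ℓ P C R2 x L K y')).sum

/-- The coin block value `⟦(r ⇂ km) ↾ m⟧`. [folklore] -/
def blockVal (r : List Bool) (m k : ℕ) : ℕ := bitsToNat ((r.drop (k * m)).take m)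

section StepValue

variable (ℓ P : ℕ) (C : ℕ → ℕ) (R2 : ℕ) (x : List Bool) (L : List (QGate iqpDiag N)) (y r : List Bool) (m k : ℕ)

/-- Value of `tFn`. [folklore] -/
theorem tFn_apply (b : Bool) :
    tFn b (sArg y r N m (encList (tableList ℓ P C R2 x L)) k) = dpEnc (tVal ℓ P C R2 x L (k + 1) (y ++ [b])) := by
  obtain ⟨hy, hk, -, hruler, -, htable⟩ := sFields y r N m (encList (tableList ℓ P C R2 x L)) k
  rw [tFn, Function.comp_apply]
  have harg : sumArgFn b (sArg y r N m (encList (tableList ℓ P C R2 x L)) k) =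
      boolPair (boolPair (y ++ [b]) (boolPair (ones (k + 1)) (ones N))) (encList (tableList ℓ P C R2 x L)) := by
    simp only [sumArgFn, fanoutFn_apply, Function.comp_apply, hy, hk, hruler, htable]
    rfl
  rw [harg, sumFn_table]; rfl

/-- Value of `uFn`: the block value as a nonnegative pair code. [folklore] -/
theorem uFn_apply (table : List Bool) : uFn (sArg y r N m table k) = boolPair (encodeNat (blockVal r m k)) [] := by
  obtain ⟨-, hk, hr, -, hm, -⟩ := sFields y r N m table k
  simp only [uFn, fanoutFn_apply, Function.comp_apply, hk, hr, hm, HashBricks.umulFn_boolPair, dropFn_boolPair,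
    List.length_replicate, lowBitsFn_boolPair_eq_encodeNat, blockVal, bitsToNat_take]

/-- Value of `twoPowMFn`. [folklore] -/
theorem twoPowMFn_apply (table : List Bool) : ival (twoPowMFn (sArg y r N m table k)) = 2 ^ m := by
  obtain ⟨-, -, -, -, hm, -⟩ := sFields y r N m table k
  simp [twoPowMFn, hm, Kannan.zerosFn_apply, bitsToNat_append]

/-- **Value of the decided bit.** [folklore] -/
theorem bitFn_apply : bitFn (sArg y r N m (encList (tableList ℓ P C R2 x L)) k) =
    [decBit m (tVal ℓ P C R2 x L (k + 1) (y ++ [false])) (tVal ℓ P C R2 x L (k + 1) (y ++ [true])) (blockVal r m k)] := by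
  have h0 := tFn_apply ℓ P C R2 x L y r m k false
  have h1 := tFn_apply ℓ P C R2 x L y r m k true
  set t0 := tVal ℓ P C R2 x L (k + 1) (y ++ [false])
  set t1 := tVal ℓ P C R2 x L (k + 1) (y ++ [true])
  unfold bitFn decBit
  rw [iteFn_apply (b := decide (0 < -t0)) (by rw [Function.comp_apply, Function.comp_apply, h0, iposFn_apply, ival_zswapF, ival_dpEnc])]
  by_cases ht0 : t0 < 0
  · rw [if_pos (by simp [ht0]), if_pos ht0]
  rw [if_neg (by simp; linarith), if_neg ht0]
  rw [iteFn_apply (b := decide (0 < -t1)) (by rw [Function.comp_apply, Function.comp_apply, h1, iposFn_apply, ival_zswapF, ival_dpEnc])]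
  by_cases ht1 : t1 < 0
  · rw [if_pos (by simp [ht1]), if_pos ht1]
  rw [if_neg (by simp; linarith), if_neg ht1]
  rw [cmpFn, Function.comp_apply, fanoutFn_apply, zleF_boolPair]
  simp only [Function.comp_apply, fanoutFn_apply, zmulF_boolPair, ival_dpEnc, twoPowMFn_apply, h0, h1, uFn_apply,
    zaddF_boolPair, ival_boolPair, bitsToNat_encodeNat, bitsToNat_nil, Nat.cast_zero, sub_zero]

/-- **Value of the sampling step.** [folklore] -/
theorem opSampFn_apply : opSampFn (sArg y r N m (encList (tableList ℓ P C R2 x L)) k) =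
    y ++ [decBit m (tVal ℓ P C R2 x L (k + 1) (y ++ [false])) (tVal ℓ P C R2 x L (k + 1) (y ++ [true])) (blockVal r m k)] := by
  rw [opSampFn, Function.comp_apply, fanoutFn_apply, appF_boolPair, bitFn_apply,
    (sFields y r N m (encList (tableList ℓ P C R2 x L)) k).1]

end StepValue

/-! ### The sampling loop and its run -/

/-- **The sampled string after `k` steps** (mathematical recursion). [cite: BremnerMontanaroShepherd2017, §3.2 (procedure)] -/
def sampleRun (ℓ P : ℕ) (C : ℕ → ℕ) (R2 : ℕ) (x : List Bool) (L : List (QGate iqpDiag N)) (r : List Bool) (m : ℕ) : ℕ → List Bool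
  | 0 => []
  | k + 1 =>
    let y := sampleRun ℓ P C R2 x L r m k
    y ++ [decBit m (tVal ℓ P C R2 x L (k + 1) (y ++ [false])) (tVal ℓ P C R2 x L (k + 1) (y ++ [true])) (blockVal r m k)]

/-- The sampled string has the right length. [folklore] -/
@[simp] theorem length_sampleRun (ℓ P : ℕ) (C : ℕ → ℕ) (R2 : ℕ) (x : List Bool) (L : List (QGate iqpDiag N)) (r : List Bool) (m : ℕ) :
    ∀ k, (sampleRun ℓ P C R2 x L r m k).length = k
  | 0 => rfl
  | k + 1 => by simp [sampleRun, length_sampleRun ℓ P C R2 x L r m k]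

/-- **The loop accumulator is `sampleRun`.** [folklore] -/
theorem foldAcc_opSampFn (ℓ P : ℕ) (C : ℕ → ℕ) (R2 : ℕ) (x : List Bool) (L : List (QGate iqpDiag N)) (r : List Bool) (m : ℕ) :
    ∀ k, foldAcc opSampFn id (sxs r N m (encList (tableList ℓ P C R2 x L))) 0 k [] = sampleRun ℓ P C R2 x L r m k
  | 0 => rfl
  | k + 1 => by
    rw [foldAcc_succ', foldAcc_opSampFn ℓ P C R2 x L r m k, zero_add, id, sampleRun]
    exact opSampFn_apply ℓ P C R2 x L _ r m k

/-- The start record of the sampling loop: `⟨xs, ⟨bin N, ⟨1^0, ε⟩⟩⟩` from `xs`. [folklore] -/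
noncomputable def sampInitFn : List Bool → List Bool :=
  fanoutFn id (fanoutFn (lenBinF ∘ nthF 1) (fun _ => boolPair [] []))

/-- `sampInitFn ∈ FP`. [folklore] -/
theorem sampInitFn_mem_FP : sampInitFn ∈ FP :=
  fanoutFn_mem_FP OracleCompose.id_mem_FP (fanoutFn_mem_FP (comp_mem_FP lenBinF_mem_FP (nthF_mem_FP 1)) (const_mem_FP _))

/-- **The sampling loop** (piece function `id` clipped at `3`). [cite: BremnerMontanaroShepherd2017, §3.2 (each sample in time poly(n))] -/
noncomputable def sampLoopFn : List Bool → List Bool := sndPow 2 ∘ foldLoop opSampFn (clipF 3 id) Polynomial.X ∘ sampInitFn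

/-- `sampLoopFn ∈ FP`. [cite: AroraBarak2009, §1.3] -/
theorem sampLoopFn_mem_FP : sampLoopFn ∈ FP :=
  comp_mem_FP (sndPow_mem_FP 2) (comp_mem_FP (foldLoop_clipF_mem_FP 3 opSampFn_mem_FP length_opSampFn_le
    OracleCompose.id_mem_FP _) sampInitFn_mem_FP)

/-- **Value of the sampling loop**: the sampled string of length `N`. [folklore] -/
theorem sampLoopFn_apply (ℓ P : ℕ) (C : ℕ → ℕ) (R2 : ℕ) (x : List Bool) (L : List (QGate iqpDiag N)) (r : List Bool) (m : ℕ) :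
    sampLoopFn (sxs r N m (encList (tableList ℓ P C R2 x L))) = sampleRun ℓ P C R2 x L r m N := by
  have hinit : sampInitFn (sxs r N m (encList (tableList ℓ P C R2 x L))) =
      boolPair (sxs r N m (encList (tableList ℓ P C R2 x L))) (boolPair (encodeNat N) (boolPair (ones 0) [])) := by
    simp [sampInitFn, sxs, nthF, lenBinF_apply]
  rw [sampLoopFn, Function.comp_apply, Function.comp_apply, hinit, foldLoop_apply _ _ (by simp [sxs]; omega) 0 _]
  simp only [sndPow, Function.comp_apply, sndF_boolPair]
  rw [foldAcc_clipF (fun j _ hj => ?_), foldAcc_opSampFn]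
  simp only [id, length_boolPair, List.length_replicate, sxs]
  omega

end Literature.Barriers.QuantumAdvantage.NoisyIQPMachine
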